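import Summits.ResolutionOfSingularities.ResolutionOfSingularities.Theses.WeightedInvariant
import Literature.AlgebraicGeometry.Resolution.NonReducedNoResolution
import Literature.AlgebraicGeometry.Resolution.AbsoluteIntegralClosureNoResolution
import Literature.AlgebraicGeometry.Resolution.QuasiProjectiveResolution
import Literature.AlgebraicGeometry.Resolution.ResolutionProjectiveReduction
import Literature.AlgebraicGeometry.Resolution.RegularLocalRingsNormal
import Literature.AlgebraicGeometry.Resolution.ProjectiveSpaceRegular
import Literature.AlgebraicGeometry.Motives.VarietiesDimensionProofs

/-!
# Disproof of `WeightedThesis` (crux stmt-ResolutionOfSingularities-0569) — findings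

Standing adversary work file (cdisprove, gen 1, v1.2 2026-08-16,
refuter-cdisprove-stmt-ResolutionOfSingularities-0569-0). Prose only in docstrings; every
`theorem` is sorry-free (no NEAR-MISS in this version).

LANDED (importable): §2 + §3 + §5 as the negative-lemma module
`Summits.ResolutionOfSingularities.ResolutionOfSingularities.Theorems.WeightedThesis.Negative.LoadBearing`
(p83033 ACCEPTED 2026-08-16, commit 6ad6eef97fec): `weightedThesis_false_without_isReduced(_at)`,
`weightedThesis_false_without_locallyOfFiniteType(_at)`, `weightedThesis_without_perfectField_iff_summit`,
`weightedThesis_without_prime_iff`, `weightedThesis_iff_minimalCase` (projective form),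
`weightedThesis_strengthening_isRegular_false` (+ `cusp_*`, `not_isRegular_spec_cusp`).

THE CRUX. `WeightedThesis` (route WeightedInvariant, rank-0 target, auto-crux 2026-08-16) is
`∀ p prime, PerfectResAt p`: every reduced separated scheme of finite type over a PERFECT field
of characteristic `p` has a resolution of singularities (`Scheme.HasResolution`: a proper
morphism from a regular scheme that is an isomorphism over a dense open with dense preimage).
It is `ResolutionInChar.{0} p` with the single extra binder `[PerfectField k]`, i.e. THE
RESOLUTION CONJECTURE OVER PERFECT FIELDS — open in dimension `≥ 4` for every prime
(`Literature.Barriers.ResolutionOfSingularities.DimensionFourFrontier`), a theorem in dimension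
`≤ 3` over every field (named fact `CossartPiltant2019`).

FINDINGS (v1.2 = v1.1 + landing note).
* §1 WEB. summit ⇒ crux, so `¬ crux ⇒ ¬ summit` (`not_summit_of_not_crux`): a kill of this crux IS a counterexample to resolution of
  singularities in positive characteristic — none is in print (lit search 2026-08-16, crossref
  cascade; local index degraded) and none of the area's pathologies (kangaroo points, Hauser–Perlega
  cycles, Cossart–Piltant Rem. 3.2, Narasimhan) is a failure of EXISTENCE, only of strategies.
  summit ↔ crux ∧ `DescentPerfectToAll` (`summit_iff_crux_and_descent`, lossless split);
  inside the route `DatumToResolution → WeightedConstruction → crux`, so a kill of the crux kills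
  `WeightedConstruction` modulo the glue (`not_construction_of_not_crux`).
* §2 LOAD-BEARING HYPOTHESES, as theorems.
  - `IsReduced X` dropped ⇒ FALSE at every prime (`not_perfectResNonreducedAt`, witness
    `Spec 𝔽_p[ε] → Spec 𝔽_p`; `weightedThesis_false_without_reduced`).
  - `LocallyOfFiniteType f` dropped ⇒ FALSE at every prime (`not_perfectResNonFiniteTypeAt`,
    witness `Spec 𝔽_p[X]⁺ → Spec 𝔽_p`, the absolute integral closure of the affine line;
    `weightedThesis_false_without_finiteType`).
  - `[PerfectField k]` dropped ⇒ literally the summit (`weightedThesisWithoutPerfect_iff_summit`,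
    `Iff.rfl`): a proof of the crux that never uses perfectness proves the summit and moots
    `DescentPerfectToAll`.
  - `p.Prime` dropped ⇒ `Hironaka1964.{0} ∧ crux` (`weightedThesisWithoutPrime_iff`): decoration
    (no field has composite or unit characteristic; `p = 0` is Hironaka, all char-0 fields being
    perfect).
  - `IsSeparated f` / `QuasiCompact f` dropped ⇒ not attackable cheaply (resolution of curves and
    surfaces is canonical, so non-separated / non-quasi-compact low-dimensional schemes still
    resolve by gluing; in dimension ≥ 4 the weakened statements contain the crux). Recorded as
    `WeightedThesisWithoutSeparated`, `WeightedThesisWithoutQuasiCompact` with only the trivial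
    implication (contrapositive) proved.
* §3 SHAPE OF A MINIMAL COUNTEREXAMPLE (what a kill must exhibit), all proved from in-tree facts:
  `PerfectResAt p ↔ IntegralPerfectResAt p` (components, `hasResolution_of_forall_closeds`)
  `↔ QuasiProjectivePerfectResAt p` (Chow's lemma `ChowLemmaIntegral_holds` +
  `Scheme.HasResolution.of_isBirational`) and, modulo the named fact `CossartPiltant2019`,
  `↔ MinimalCaseAt p` (INTEGRAL, dimension `≥ 4`, IMMERSED IN SOME `ℙⁿ_k`)
  `↔ ProjectiveMinimalCaseAt p` (projective closure, `exists_projectiveClosure` +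
  `Scheme.HasResolution.of_isOpenImmersion`): a kill is an integral CLOSED subscheme of some
  `ℙⁿ_k` of dimension `≥ 4`, `k` perfect of characteristic `p`, without resolution
  (`crux_iff_minimalCase`). Nothing smaller can kill the crux.
* §4 DEGENERATE INSTANCES DO NOT BITE: the hypotheses are jointly satisfiable and the conclusion
  holds there (`hypotheses_satisfiable`: `Spec 𝔽_p`; `minimalCase_hypotheses_satisfiable`: `ℙ⁴`), the empty scheme and spectra of fields
  resolve themselves, dimension `≤ 3` is covered by `CossartPiltant2019`
  (`perfectResAt_of_dim_le_three`).
* §5 NATURAL STRENGTHENINGS: all fields (= summit, open); non-reduced / non-finite-type (FALSE,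
  §2); "`X` itself is regular" (the identity as resolution) FALSE at every prime
  (`not_strengthening_isRegular`, witness the cuspidal cubic `Spec 𝔽_p[T², T³]`: `T = T³/T²` is
  integral and not in `𝔽_p[T², T³]`, so some localisation at a maximal ideal is not integrally
  closed, hence not regular by Matsumura 19.4 = `isIntegrallyClosed_of_isRegularLocalRing` in
  tree) — i.e. the conclusion `HasResolution X` is not witnessed by `𝟙 X` in general, the crux has
  content at every prime already in dimension 1.
* Targets: none yet (payload `stuck_stubs = []`); re-arm will add the lead's stubs here.

BARRIER CATALOGUE (`Literature/Barriers/ResolutionOfSingularities/`) versus THIS crux.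
* `DimensionFourFrontier` — a FRONTIER entry: prints that resolution / local uniformization are
  open in dimension `≥ 4` and where the dimension-3 proofs use dimension 3 (CP 2019 Rem. 3.2);
  asserts no falsity. Consistent with §3/§4: the crux is settled exactly up to dimension 3.
* `QuasiExcellenceNecessary` (Grothendieck EGA IV 7.9.5, Nagata) — bites only statements wider
  than finite type over a field; the crux keeps `LocallyOfFiniteType`, and §2 shows it must.
* `InseparableBaseChange(Resolution)`, `RegularNotGeometricallyRegular`, `FrobeniusTwistResolution`
  — concern imperfect ground fields / descent (crux `DescentPerfectToAll`), not this crux: over a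
  perfect field regular = geometrically regular.
* `NarasimhanMaximalContact`, `KangarooShadeIncrease`, `ResidualOrderUnbounded*`,
  `hauserPerlega…`, `DirectrixSmallCharacteristic`, `ArtinSchreierPuiseux` — failures of specific
  embedded-resolution STRATEGIES (maximal contact, residual order, point blow-ups), i.e. they bear
  on `WeightedConstruction` / `LocalWeightedDrop`, not on the existence statement here.
* `LocalMonomializationFails*` (Cutkosky) — monomialization of MORPHISMS fails in char p; not a
  statement about resolving a single variety.
None of the catalogued barriers yields `¬ WeightedThesis`; `ledger negatives` lists 0 refuted
statements for the summit (2026-08-16).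

WHY IT RESISTS. The statement is faithful (each hypothesis is necessary with an in-tree witness,
§2; the conclusion is the standard weak resolution, honest by `IsBirational`'s dense-preimage
clause) and its negation is a dimension-≥ 4 counterexample to resolution over a perfect field
(§3) — a major open problem with no candidate in the literature. Cheap attacks (junk models,
degenerate parameters, hypothesis mutation, small models) are exhausted by §2–§4; the crux can only
fall to new mathematics, not to a refuter.
-/

noncomputable section

open CategoryTheory AlgebraicGeometry TopologicalSpace
open Literature.AlgebraicGeometry.Resolution
open Summit.ResolutionOfSingularities.ResolutionOfSingularities.Theses.WeightedInvariant

set_option linter.dupNamespace false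

namespace Summit.ResolutionOfSingularities.ResolutionOfSingularities.Cruxes.WeightedThesis.Disproof

/-! ## §0 The crux by name -/

/-- Resolution of reduced separated schemes of finite type over PERFECT fields of characteristic
`p`: the body of the crux at a fixed `p` (= `ResolutionInChar.{0} p` with `[PerfectField k]`
added). -/
def PerfectResAt (p : ℕ) : Prop :=
  ∀ (k : Type) [Field k] [CharP k p] [PerfectField k] (X : Scheme.{0}) (f : X ⟶ Spec (.of k)),
    IsSeparated f → LocallyOfFiniteType f → QuasiCompact f → IsReduced X → Scheme.HasResolution X

/-- Unfolding: the crux is `∀ p prime, PerfectResAt p`. [folklore] -/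
theorem crux_iff : WeightedThesis ↔ ∀ p : ℕ, p.Prime → PerfectResAt p := Iff.rfl

/-! ## §1 Position in the implication web -/

/-- Resolution over all fields of characteristic `p` gives it over perfect ones. [folklore] -/
theorem perfectResAt_of_resolutionInChar {p : ℕ} (h : ResolutionInChar.{0} p) : PerfectResAt p :=
  fun k _ _ _ X f a b c d => h k X f a b c d

/-- **A kill of the crux is a counterexample to resolution of singularities in positive
characteristic**: the crux is a special case of the summit statement (perfect ⊂ all fields), so
`¬ crux ⇒ ¬ summit`. Stated negatively on purpose (this file credits no positive item).
[folklore] -/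
theorem not_summit_of_not_crux (h : ¬ WeightedThesis) : ¬ _root_.ResolutionOfSingularities :=
  fun hs => h fun p hp => perfectResAt_of_resolutionInChar (hs p hp)

/-- Lossless split of the summit along this route: summit ↔ crux ∧ `DescentPerfectToAll` (the
route's deciding theorem `closes` is the direction ←). [folklore] -/
theorem summit_iff_crux_and_descent :
    _root_.ResolutionOfSingularities ↔ WeightedThesis ∧ DescentPerfectToAll :=
  ⟨fun h => ⟨fun p hp => perfectResAt_of_resolutionInChar (h p hp), fun p hp _ => h p hp⟩,
    -- buildfix 2026-08-19: `closes` is now `WeightedConstruction → DatumToEmbedded → DescentPerfectToAll → …`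
    -- (it derives this crux internally); its descent step `crux → DescentPerfectToAll → summit` is inlined.
    fun h => fun p hp => h.2 p hp (h.1 p hp)⟩

/-- Once the crux holds, the shared descent crux `DescentPerfectToAll` is EXACTLY the summit
(so the two hypotheses of `closes` are independent targets: neither is decoration).
[folklore] -/
theorem descent_iff_summit_of_crux (h : WeightedThesis) :
    DescentPerfectToAll ↔ _root_.ResolutionOfSingularities :=
  ⟨fun hD => fun p hp => hD p hp (h p hp), fun hs p hp _ => hs p hp⟩

/-- Inside the route the crux is reached as `DatumToResolution → WeightedConstruction → crux`
(by application); contrapositively, **a kill of the crux kills `WeightedConstruction`** (the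
existence of a weighted resolution datum at some prime) modulo the glue `DatumToResolution`.
[folklore] -/
theorem not_construction_of_not_crux (h : ¬ WeightedThesis) (hD : DatumToResolution) :
    ¬ WeightedConstruction :=
  fun hC => h fun p hp k _ _ _ X f a b c d => hD p hp (hC p hp) k X f a b c d

/-! ## §2 Load-bearing hypotheses -/

/-- The body of the crux at `p` with `IsReduced X` DROPPED. -/
def PerfectResNonreducedAt (p : ℕ) : Prop :=
  ∀ (k : Type) [Field k] [CharP k p] [PerfectField k] (X : Scheme.{0}) (f : X ⟶ Spec (.of k)),
    IsSeparated f → LocallyOfFiniteType f → QuasiCompact f → Scheme.HasResolution X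

/-- **`IsReduced` is load-bearing, at every prime**: `Spec 𝔽_p[ε] → Spec 𝔽_p` is affine (hence
separated and quasi-compact) and of finite type over the perfect field `𝔽_p`, but `Spec 𝔽_p[ε]`
has no resolution (`not_hasResolution_spec_dualNumber`: a dense open of the one-point space is
everything, and `𝔽_p[ε]` is not a regular local ring). [folklore] -/
theorem not_perfectResNonreducedAt (p : ℕ) [Fact p.Prime] : ¬ PerfectResNonreducedAt p := by
  intro h
  haveI : Module.Finite (ZMod p) (DualNumber (ZMod p)) :=
    inferInstanceAs (Module.Finite (ZMod p) (ZMod p × ZMod p))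
  let f : Spec (.of (DualNumber (ZMod p))) ⟶ Spec (.of (ZMod p)) :=
    Spec.map (CommRingCat.ofHom (algebraMap (ZMod p) (DualNumber (ZMod p))))
  haveI : LocallyOfFiniteType f :=
    (HasRingHomProperty.Spec_iff (P := @LocallyOfFiniteType)).mpr
      (RingHom.finiteType_algebraMap.mpr inferInstance)
  exact not_hasResolution_spec_dualNumber (ZMod p)
    (h (ZMod p) (Spec (.of (DualNumber (ZMod p)))) f inferInstance inferInstance inferInstance)

/-- The crux with `IsReduced X` dropped. -/
def WeightedThesisWithoutReduced : Prop := ∀ p : ℕ, p.Prime → PerfectResNonreducedAt p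

/-- **Any proof of the crux must use `IsReduced X`** (already `p = 2` fails). [folklore] -/
theorem weightedThesis_false_without_reduced : ¬ WeightedThesisWithoutReduced := fun h =>
  haveI : Fact (Nat.Prime 2) := ⟨Nat.prime_two⟩
  not_perfectResNonreducedAt 2 (h 2 Nat.prime_two)

/-- The body of the crux at `p` with `LocallyOfFiniteType f` DROPPED. -/
def PerfectResNonFiniteTypeAt (p : ℕ) : Prop :=
  ∀ (k : Type) [Field k] [CharP k p] [PerfectField k] (X : Scheme.{0}) (f : X ⟶ Spec (.of k)),
    IsSeparated f → QuasiCompact f → IsReduced X → Scheme.HasResolution X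

/-- **`LocallyOfFiniteType` is load-bearing, at every prime**: `Spec 𝔽_p[X]⁺ → Spec 𝔽_p` (the
absolute integral closure of the affine line) is affine and reduced over the perfect field `𝔽_p`
but has no resolution (`not_hasResolution_spec_absoluteIntegralClosure`: every element is a
square, so no non-generic stalk is Noetherian, let alone regular). [folklore] -/
theorem not_perfectResNonFiniteTypeAt (p : ℕ) [Fact p.Prime] : ¬ PerfectResNonFiniteTypeAt p := by
  intro h
  let f : Spec (.of ↥(integralClosure (Polynomial (ZMod p))
      (AlgebraicClosure (RatFunc (ZMod p))))) ⟶ Spec (.of (ZMod p)) :=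
    Spec.map (CommRingCat.ofHom ((algebraMap (Polynomial (ZMod p))
      ↥(integralClosure (Polynomial (ZMod p)) (AlgebraicClosure (RatFunc (ZMod p))))).comp
        Polynomial.C))
  exact not_hasResolution_spec_absoluteIntegralClosure p
    (h (ZMod p) _ f inferInstance inferInstance inferInstance)

/-- The crux with `LocallyOfFiniteType f` dropped. -/
def WeightedThesisWithoutFiniteType : Prop := ∀ p : ℕ, p.Prime → PerfectResNonFiniteTypeAt p

/-- **Any proof of the crux must use `LocallyOfFiniteType f`** (already `p = 2` fails).
[folklore] -/
theorem weightedThesis_false_without_finiteType : ¬ WeightedThesisWithoutFiniteType := fun h =>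
  haveI : Fact (Nat.Prime 2) := ⟨Nat.prime_two⟩
  not_perfectResNonFiniteTypeAt 2 (h 2 Nat.prime_two)

/-- The crux with `[PerfectField k]` DROPPED. -/
def WeightedThesisWithoutPerfect : Prop :=
  ∀ p : ℕ, p.Prime → ∀ (k : Type) [Field k] [CharP k p] (X : Scheme.{0}) (f : X ⟶ Spec (.of k)),
    IsSeparated f → LocallyOfFiniteType f → QuasiCompact f → IsReduced X → Scheme.HasResolution X

/-- **Dropping perfectness gives literally the summit statement** (so `[PerfectField k]` is the
only hypothesis separating the crux from the conjecture; a proof not using it proves the summit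
and moots `DescentPerfectToAll`). [folklore] -/
theorem weightedThesisWithoutPerfect_iff_summit :
    WeightedThesisWithoutPerfect ↔ _root_.ResolutionOfSingularities := Iff.rfl

/-- The crux with `p.Prime` DROPPED. -/
def WeightedThesisWithoutPrime : Prop := ∀ p : ℕ, PerfectResAt p

/-- **`p.Prime` is decoration modulo Hironaka**: without it the statement is
`Hironaka1964.{0} ∧ crux` — at `p = 0` every field is perfect (Hironaka's theorem, a named fact),
and no field has characteristic `1` or a composite characteristic (those instances are vacuous).
[folklore] -/
theorem weightedThesisWithoutPrime_iff :
    WeightedThesisWithoutPrime ↔ Hironaka1964.{0} ∧ WeightedThesis := by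
  constructor
  · intro h
    refine ⟨?_, fun p _ => h p⟩
    intro k _ _ X f a b c d
    haveI : CharZero k := CharP.charP_to_charZero k
    exact h 0 k X f a b c d
  · rintro ⟨h0, h⟩ p k _ _ _ X f a b c d
    rcases CharP.char_is_prime_or_zero k p with hp | rfl
    · exact h p hp k X f a b c d
    · exact h0 k X f a b c d

/-- The crux with `IsSeparated f` DROPPED (status: open, contains the crux; not attackable by
junk — a non-separated reduced curve or surface still resolves, resolution being canonical in
dimension ≤ 2). -/
def WeightedThesisWithoutSeparated : Prop :=
  ∀ p : ℕ, p.Prime → ∀ (k : Type) [Field k] [CharP k p] [PerfectField k] (X : Scheme.{0})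
    (f : X ⟶ Spec (.of k)), LocallyOfFiniteType f → QuasiCompact f → IsReduced X →
      Scheme.HasResolution X

/-- The trivial direction, contrapositively: a kill of the crux kills it. [folklore] -/
theorem not_withoutSeparated_of_not_crux (h : ¬ WeightedThesis) : ¬ WeightedThesisWithoutSeparated :=
  fun h' => h fun p hp k _ _ _ X f _ b c d => h' p hp k X f b c d

/-- The crux with `QuasiCompact f` DROPPED (status: open, contains the crux; an infinite
disjoint union of singular curves still resolves componentwise). -/
def WeightedThesisWithoutQuasiCompact : Prop :=
  ∀ p : ℕ, p.Prime → ∀ (k : Type) [Field k] [CharP k p] [PerfectField k] (X : Scheme.{0})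
    (f : X ⟶ Spec (.of k)), IsSeparated f → LocallyOfFiniteType f → IsReduced X →
      Scheme.HasResolution X

/-- The trivial direction, contrapositively: a kill of the crux kills it. [folklore] -/
theorem not_withoutQuasiCompact_of_not_crux (h : ¬ WeightedThesis) :
    ¬ WeightedThesisWithoutQuasiCompact :=
  fun h' => h fun p hp k _ _ _ X f a b _ d => h' p hp k X f a b d

/-! ## §3 Shape of a minimal counterexample -/

/-- The integral case at `p`. -/
def IntegralPerfectResAt (p : ℕ) : Prop :=
  ∀ (k : Type) [Field k] [CharP k p] [PerfectField k] (X : Scheme.{0}) (f : X ⟶ Spec (.of k)),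
    IsSeparated f → LocallyOfFiniteType f → QuasiCompact f → IsIntegral X → Scheme.HasResolution X

open Scheme.IdealSheafData in
/-- **WLOG `X` integral**: resolve the (finitely many) irreducible components with their reduced
structure and glue (`hasResolution_of_forall_closeds`). [folklore] -/
theorem perfectResAt_iff_integral (p : ℕ) : PerfectResAt p ↔ IntegralPerfectResAt p := by
  constructor
  · intro h k _ _ _ X f hsep hft hqc hint
    exact h k X f hsep hft hqc inferInstance
  · intro h k _ _ _ X f hsep hft hqc hred
    refine hasResolution_of_forall_closeds X f fun Z hZ => ?_
    exact h k _ ((vanishingIdeal Z).subschemeι ≫ f) inferInstance inferInstance inferInstance hZ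

/-- The integral quasi-projective case at `p`: integral schemes immersed in some `ℙⁿ_k`, `k`
perfect of characteristic `p`. -/
def QuasiProjectivePerfectResAt (p : ℕ) : Prop :=
  ∀ (k : Type) [Field k] [CharP k p] [PerfectField k] (n : ℕ) (X : Scheme.{0})
    (ι : X ⟶ (Literature.AlgebraicGeometry.Motives.projectiveSpace n k).left),
    IsImmersion ι → IsIntegral X → Scheme.HasResolution X

/-- An integral scheme immersed in `ℙⁿ_k` is a reduced separated `k`-scheme of finite type, so
the crux covers it. [folklore] -/
theorem quasiProjectivePerfectResAt_of_perfectResAt {p : ℕ} (h : PerfectResAt p) :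
    QuasiProjectivePerfectResAt p := by
  intro k _ _ _ n X ι hι hint
  haveI := hι
  haveI := hint
  haveI : IsProper (Literature.AlgebraicGeometry.Motives.projectiveSpace n k).hom :=
    Literature.AlgebraicGeometry.Motives.isProper_projectiveSpace n k
  haveI : IsLocallyNoetherian (Literature.AlgebraicGeometry.Motives.projectiveSpace n k).left :=
    LocallyOfFiniteType.isLocallyNoetherian
      (Literature.AlgebraicGeometry.Motives.projectiveSpace n k).hom
  haveI : CompactSpace (Literature.AlgebraicGeometry.Motives.projectiveSpace n k).left :=
    QuasiCompact.compactSpace_of_compactSpace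
      (Literature.AlgebraicGeometry.Motives.projectiveSpace n k).hom
  haveI : IsNoetherian (Literature.AlgebraicGeometry.Motives.projectiveSpace n k).left := {}
  haveI : NoetherianSpace X := ι.isEmbedding.isInducing.noetherianSpace
  exact h k X (ι ≫ (Literature.AlgebraicGeometry.Motives.projectiveSpace n k).hom) inferInstance
    inferInstance inferInstance inferInstance

/-- **WLOG `X` integral and quasi-projective**: by Chow's lemma (`ChowLemmaIntegral_holds`,
proved in the tree) an integral separated `X` of finite type over `k` receives a proper
birational morphism from an integral `X'` immersed in some `ℙⁿ_k`, and proper birational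
morphisms transport resolutions (`Scheme.HasResolution.of_isBirational`). [folklore] -/
theorem perfectResAt_iff_quasiProjective (p : ℕ) :
    PerfectResAt p ↔ QuasiProjectivePerfectResAt p := by
  refine ⟨quasiProjectivePerfectResAt_of_perfectResAt, fun h => ?_⟩
  rw [perfectResAt_iff_integral]
  intro k _ _ _ X f hsep hft hqc hint
  obtain ⟨n, X', π, ι, hint', hι, hπ, -, -, U, hU, hU', hiso⟩ :=
    ChowLemmaIntegral_holds k X f hsep hft hqc hint
  haveI := hπ
  exact Scheme.HasResolution.of_isBirational π ⟨U, hU, hU', hiso⟩ (h k n X' ι hι hint')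

/-- The minimal case at `p`: integral, immersed in some `ℙⁿ_k` over a perfect field of
characteristic `p`, and of dimension `> 3`. -/
def MinimalCaseAt (p : ℕ) : Prop :=
  ∀ (k : Type) [Field k] [CharP k p] [PerfectField k] (n : ℕ) (X : Scheme.{0})
    (ι : X ⟶ (Literature.AlgebraicGeometry.Motives.projectiveSpace n k).left),
    IsImmersion ι → IsIntegral X → ¬ topologicalKrullDim X ≤ 3 → Scheme.HasResolution X

/-- **Shape of a minimal counterexample.** Modulo the named fact `CossartPiltant2019`
(dimension `≤ 3`, every field), the crux at `p` is equivalent to its integral quasi-projective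
case in dimension `≥ 4`: a kill must be an integral `X ↪ ℙⁿ_k` of dimension at least four over
a perfect field of characteristic `p` admitting no proper birational morphism from a regular
scheme. [folklore] -/
theorem perfectResAt_iff_minimalCase (hCP : CossartPiltant2019.{0}) (p : ℕ) :
    PerfectResAt p ↔ MinimalCaseAt p := by
  rw [perfectResAt_iff_quasiProjective]
  refine ⟨fun h k _ _ _ n X ι hι hint _ => h k n X ι hι hint, fun h => ?_⟩
  intro k _ _ _ n X ι hι hint
  by_cases hdim : topologicalKrullDim X ≤ 3
  · haveI := hι
    haveI := hint
    haveI : IsProper (Literature.AlgebraicGeometry.Motives.projectiveSpace n k).hom :=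
      Literature.AlgebraicGeometry.Motives.isProper_projectiveSpace n k
    haveI : IsLocallyNoetherian (Literature.AlgebraicGeometry.Motives.projectiveSpace n k).left :=
      LocallyOfFiniteType.isLocallyNoetherian
        (Literature.AlgebraicGeometry.Motives.projectiveSpace n k).hom
    haveI : CompactSpace (Literature.AlgebraicGeometry.Motives.projectiveSpace n k).left :=
      QuasiCompact.compactSpace_of_compactSpace
        (Literature.AlgebraicGeometry.Motives.projectiveSpace n k).hom
    haveI : IsNoetherian (Literature.AlgebraicGeometry.Motives.projectiveSpace n k).left := {}
    haveI : NoetherianSpace X := ι.isEmbedding.isInducing.noetherianSpace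
    exact hCP k X (ι ≫ (Literature.AlgebraicGeometry.Motives.projectiveSpace n k).hom)
      inferInstance inferInstance inferInstance inferInstance hdim
  · exact h k n X ι hι hint hdim

/-- The PROJECTIVE minimal case at `p`: integral closed subschemes of `ℙⁿ_k`, `k` perfect of
characteristic `p`, of dimension `> 3`. -/
def ProjectiveMinimalCaseAt (p : ℕ) : Prop :=
  ∀ (k : Type) [Field k] [CharP k p] [PerfectField k] (n : ℕ) (X : Scheme.{0})
    (ι : X ⟶ (Literature.AlgebraicGeometry.Motives.projectiveSpace n k).left),
    IsClosedImmersion ι → IsIntegral X → ¬ topologicalKrullDim X ≤ 3 → Scheme.HasResolution X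

/-- **WLOG projective**: the minimal case is equivalent to its projective sub-case — an integral
`X ↪ ℙⁿ_k` is a dense open of its scheme-theoretic closure `X̄` (integral, closed in `ℙⁿ_k`, of
the same dimension: `exists_projectiveClosure`), and a resolution of `X̄` restricts to one of `X`
(`Scheme.HasResolution.of_isOpenImmersion`). [folklore] -/
theorem minimalCaseAt_iff_projective (p : ℕ) : MinimalCaseAt p ↔ ProjectiveMinimalCaseAt p := by
  refine ⟨fun h k _ _ _ n X ι hι hint hdim => ?_, fun h k _ _ _ n X ι hι hint hdim => ?_⟩
  · haveI := hι
    exact h k n X ι inferInstance hint hdim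
  · haveI := hι
    haveI := hint
    obtain ⟨Xbar, j, c, hXbar, hj, hc, -, hdimbar⟩ := exists_projectiveClosure ι
    haveI := hj
    exact (h k n Xbar c hc hXbar (hdimbar ▸ hdim)).of_isOpenImmersion j

/-- **Shape of a minimal counterexample, final form (v1.1).** Modulo `CossartPiltant2019`, the
crux at `p` is equivalent to: every INTEGRAL CLOSED subscheme of some `ℙⁿ_k` of dimension `≥ 4`,
`k` perfect of characteristic `p`, has a resolution. A kill is a projective variety of dimension
at least four over a perfect field with no proper birational morphism from a regular scheme.
[folklore] -/
theorem perfectResAt_iff_projectiveMinimalCase (hCP : CossartPiltant2019.{0}) (p : ℕ) :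
    PerfectResAt p ↔ ProjectiveMinimalCaseAt p := by
  rw [perfectResAt_iff_minimalCase hCP, minimalCaseAt_iff_projective]

/-- Hence, modulo `CossartPiltant2019`, the whole crux is `∀ p prime, ProjectiveMinimalCaseAt p`.
[folklore] -/
theorem crux_iff_minimalCase (hCP : CossartPiltant2019.{0}) :
    WeightedThesis ↔ ∀ p : ℕ, p.Prime → ProjectiveMinimalCaseAt p := by
  simp only [crux_iff, perfectResAt_iff_projectiveMinimalCase hCP]

/-! ## §4 Degenerate instances do not bite -/

/-- The empty scheme (and any scheme with no points) resolves itself. [folklore] -/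
theorem hasResolution_of_isEmpty (X : Scheme.{0}) [IsEmpty X] : Scheme.HasResolution X :=
  Scheme.IsRegular.hasResolution fun x => isEmptyElim x

/-- The spectrum of a field resolves itself. [folklore] -/
theorem hasResolution_Spec_field (K : Type) [Field K] : Scheme.HasResolution (Spec (.of K)) := by
  refine Scheme.IsRegular.hasResolution fun x => ?_
  haveI : IsRegularLocalRing (Localization.AtPrime x.asIdeal) :=
    IsRegularRing.isRegularLocalRing_localization x.asIdeal
  exact IsRegularLocalRing.of_ringEquiv (Spec.stalkIso (.of K) x).commRingCatIsoToRingEquiv.symm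

/-- **Non-vacuity**: at every prime the hypotheses of the crux are jointly satisfiable and the
conclusion holds at the witness (`X = Spec 𝔽_p`, `f = 𝟙`). [folklore] -/
theorem hypotheses_satisfiable (p : ℕ) [Fact p.Prime] :
    ∃ (k : Type) (_ : Field k) (_ : CharP k p) (_ : PerfectField k) (X : Scheme.{0})
      (f : X ⟶ Spec (.of k)), IsSeparated f ∧ LocallyOfFiniteType f ∧ QuasiCompact f ∧
        IsReduced X ∧ Scheme.HasResolution X :=
  ⟨ZMod p, inferInstance, inferInstance, inferInstance, Spec (.of (ZMod p)), 𝟙 _, inferInstance,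
    inferInstance, inferInstance, inferInstance, hasResolution_Spec_field (ZMod p)⟩

/-- **Non-vacuity of the minimal case**: the hypotheses of `MinimalCaseAt p` are jointly
satisfiable at every prime — `ℙ⁴_{𝔽_p}` with the identity immersion is integral of dimension `4`
(`topologicalKrullDim_eq_of_smoothOfRelativeDimension`) — and the conclusion holds there, `ℙ⁴`
being regular (`isRegular_projectiveSpace`). So §3 does not reduce the crux to an empty case.
[folklore] -/
theorem minimalCase_hypotheses_satisfiable (p : ℕ) [Fact p.Prime] :
    ∃ (k : Type) (_ : Field k) (_ : CharP k p) (_ : PerfectField k) (n : ℕ) (X : Scheme.{0})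
      (ι : X ⟶ (Literature.AlgebraicGeometry.Motives.projectiveSpace n k).left),
        IsImmersion ι ∧ IsIntegral X ∧ ¬ topologicalKrullDim X ≤ 3 ∧ Scheme.HasResolution X := by
  haveI : IsIntegral (Literature.AlgebraicGeometry.Motives.projectiveSpace 4 (ZMod p)).left :=
    isIntegral_projectiveSpace 4 (ZMod p)
  haveI : SmoothOfRelativeDimension 4
      (Literature.AlgebraicGeometry.Motives.projectiveSpace 4 (ZMod p)).hom :=
    (Literature.AlgebraicGeometry.Motives.isSmoothProjective_projectiveSpace_holds (ZMod p) 4)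
      |>.smoothOfRelativeDimension
  refine ⟨ZMod p, inferInstance, inferInstance, inferInstance, 4,
    (Literature.AlgebraicGeometry.Motives.projectiveSpace 4 (ZMod p)).left, 𝟙 _, inferInstance,
    inferInstance, fun h4 => ?_, (isRegular_projectiveSpace 4 (ZMod p)).hasResolution⟩
  rw [Literature.AlgebraicGeometry.Motives.topologicalKrullDim_eq_of_smoothOfRelativeDimension
    (Literature.AlgebraicGeometry.Motives.projectiveSpace 4 (ZMod p)).hom 4] at h4
  have : (4 : ℕ) ≤ 3 := by exact_mod_cast h4
  omega

/-- **Dimension `≤ 3` is settled** (named fact `CossartPiltant2019`, every field): a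
counterexample has dimension `≥ 4`. [cite: CossartPiltant2019, Thm. 1.1] -/
theorem perfectResAt_of_dim_le_three (hCP : CossartPiltant2019.{0}) {p : ℕ} (k : Type) [Field k]
    [CharP k p] [PerfectField k] (X : Scheme.{0}) (f : X ⟶ Spec (.of k)) [IsSeparated f]
    [LocallyOfFiniteType f] [QuasiCompact f] [IsReduced X] (hdim : topologicalKrullDim X ≤ 3) :
    Scheme.HasResolution X :=
  hCP k X f ‹_› ‹_› ‹_› ‹_› hdim

/-! ## §5 Natural strengthenings

* all fields instead of perfect ones: the summit (`weightedThesisWithoutPerfect_iff_summit`), open;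
* non-reduced `X` / `X` not of finite type: FALSE (§2);
* "`X` itself is regular" (resolution by the identity): FALSE at every prime — the cuspidal cubic
  below.
-/

section Cusp

open Polynomial

variable (K : Type) [Field K]

/-- Elements of the cusp algebra `K[T², T³] = Algebra.adjoin K {T², T³} ⊆ K[T]` have no linear
term. [folklore] -/
theorem cusp_coeff_one_eq_zero {s : K[X]}
    (hs : s ∈ Algebra.adjoin K ({X ^ 2, X ^ 3} : Set K[X])) : s.coeff 1 = 0 := by
  refine Algebra.adjoin_induction (p := fun s _ => s.coeff 1 = 0) ?_ ?_ ?_ ?_ hs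
  · intro x hx
    simp only [Set.mem_insert_iff, Set.mem_singleton_iff] at hx
    rcases hx with hx | hx <;> rw [hx, Polynomial.coeff_X_pow] <;> simp
  · intro r
    show (algebraMap K K[X] r).coeff 1 = 0
    rw [Polynomial.algebraMap_apply, Polynomial.coeff_C]
    simp
  · intro x y _ _ hx hy
    simp [hx, hy]
  · intro x y _ _ hx hy
    simp [Polynomial.coeff_mul, Finset.Nat.sum_antidiagonal_succ, hx, hy]

/-- `T ∉ K[T², T³]`. [folklore] -/
theorem cusp_X_not_mem : (X : K[X]) ∉ Algebra.adjoin K ({X ^ 2, X ^ 3} : Set K[X]) := fun h => by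
  simpa using cusp_coeff_one_eq_zero K h

/-- `K[T², T³]` is not integrally closed: `T = T³/T²` is integral over it (`T² ∈ K[T², T³]`)
but not in it. [folklore] -/
theorem cusp_not_isIntegrallyClosed :
    ¬ IsIntegrallyClosed ↥(Algebra.adjoin K ({X ^ 2, X ^ 3} : Set K[X])) := by
  intro h
  set A : Subalgebra K K[X] := Algebra.adjoin K ({X ^ 2, X ^ 3} : Set K[X]) with hA
  have h2 : (X ^ 2 : K[X]) ∈ A := Algebra.subset_adjoin (by simp)
  have h3 : (X ^ 3 : K[X]) ∈ A := Algebra.subset_adjoin (by simp)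
  let a2 : A := ⟨X ^ 2, h2⟩
  let a3 : A := ⟨X ^ 3, h3⟩
  have ha2 : a2 ≠ 0 := by
    intro h0
    have := congrArg Subtype.val h0
    simp [a2] at this
  let L := FractionRing A
  have ha2L : algebraMap A L a2 ≠ 0 := fun h0 =>
    ha2 ((IsFractionRing.injective A L) (h0.trans (map_zero _).symm))
  let x : L := algebraMap A L a3 / algebraMap A L a2
  have hx2 : x ^ 2 = algebraMap A L a2 := by
    rw [div_pow, div_eq_iff (pow_ne_zero 2 ha2L), ← map_pow, ← map_pow, ← map_mul]
    congr 1
    apply Subtype.ext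
    simp [a2, a3]
    ring
  obtain ⟨y, hy⟩ := IsIntegrallyClosed.exists_algebraMap_eq_of_isIntegral_pow (R := A) (K := L)
    two_pos (hx2 ▸ isIntegral_algebraMap)
  have hy' : algebraMap A L (y * a2) = algebraMap A L a3 := by
    rw [map_mul, hy, div_mul_cancel₀ _ ha2L]
  have hy'' : y * a2 = a3 := IsFractionRing.injective A L hy'
  have hval : (y : K[X]) * X ^ 2 = X ^ 3 := by
    have := congrArg Subtype.val hy''
    simpa [a2, a3] using this
  have hyX : (y : K[X]) = X := by
    have hX2 : (X ^ 2 : K[X]) ≠ 0 := pow_ne_zero 2 X_ne_zero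
    apply mul_right_cancel₀ hX2
    rw [hval]; ring
  have hXA : (X : K[X]) ∈ A := by rw [← hyX]; exact y.2
  exact cusp_X_not_mem K hXA

/-- Some maximal ideal of `K[T², T³]` has a NON-regular local ring (else every localisation at a
maximal ideal would be integrally closed — Matsumura 19.4, `isIntegrallyClosed_of_isRegularLocalRing`
— hence so would `K[T², T³]`, `IsIntegrallyClosed.of_localization_maximal`). [folklore] -/
theorem cusp_exists_not_isRegularLocalRing :
    ∃ (m : Ideal ↥(Algebra.adjoin K ({X ^ 2, X ^ 3} : Set K[X]))) (_ : m.IsMaximal),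
      ¬ IsRegularLocalRing (Localization.AtPrime m) := by
  by_contra hall
  simp only [not_exists, not_not] at hall
  refine cusp_not_isIntegrallyClosed K
    (IsIntegrallyClosed.of_localization_maximal fun m _ hm => ?_)
  haveI := hall m hm
  exact isIntegrallyClosed_of_isRegularLocalRing _

/-- **The cuspidal cubic `Spec K[T², T³]` is not a regular scheme.** [folklore] -/
theorem not_isRegular_spec_cusp :
    ¬ Scheme.IsRegular (Spec (.of ↥(Algebra.adjoin K ({X ^ 2, X ^ 3} : Set K[X])))) := by
  intro h
  obtain ⟨m, hm, hreg⟩ := cusp_exists_not_isRegularLocalRing K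
  let x : PrimeSpectrum ↥(Algebra.adjoin K ({X ^ 2, X ^ 3} : Set K[X])) := ⟨m, hm.isPrime⟩
  haveI := h x
  exact hreg (IsRegularLocalRing.of_ringEquiv
    (Spec.stalkIso (.of ↥(Algebra.adjoin K ({X ^ 2, X ^ 3} : Set K[X]))) x).commRingCatIsoToRingEquiv)

/-- **Strengthening refuted, at every prime: not every reduced separated scheme of finite type
over a perfect field of characteristic `p` is regular** — the conclusion `HasResolution X` of the
crux is not witnessed by the identity in general. Witness: the cuspidal cubic
`Spec 𝔽_p[T², T³] → Spec 𝔽_p` (affine, of finite type, reduced as a subring of `𝔽_p[T]`).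
[folklore] -/
theorem not_strengthening_isRegular (p : ℕ) [Fact p.Prime] :
    ¬ ∀ (k : Type) [Field k] [CharP k p] [PerfectField k] (Y : Scheme.{0})
        (f : Y ⟶ Spec (.of k)), IsSeparated f → LocallyOfFiniteType f → QuasiCompact f →
          IsReduced Y → Scheme.IsRegular Y := by
  intro h
  let A : Subalgebra (ZMod p) (ZMod p)[X] :=
    Algebra.adjoin (ZMod p) ({X ^ 2, X ^ 3} : Set (ZMod p)[X])
  haveI : Algebra.FiniteType (ZMod p) ↥A := by
    refine ⟨(Subalgebra.fg_top A).mpr ⟨{X ^ 2, X ^ 3}, ?_⟩⟩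
    simp [A]
  let f : Spec (.of ↥A) ⟶ Spec (.of (ZMod p)) :=
    Spec.map (CommRingCat.ofHom (algebraMap (ZMod p) ↥A))
  haveI : LocallyOfFiniteType f :=
    (HasRingHomProperty.Spec_iff (P := @LocallyOfFiniteType)).mpr
      (RingHom.finiteType_algebraMap.mpr inferInstance)
  exact not_isRegular_spec_cusp (ZMod p)
    (h (ZMod p) (Spec (.of ↥A)) f inferInstance inferInstance inferInstance inferInstance)

end Cusp

/-! ## Targets

None yet: payload `stuck_stubs = []` (no line picked on this crux). -/

end Summit.ResolutionOfSingularities.ResolutionOfSingularities.Cruxes.WeightedThesis.Disproof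

end
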